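import Summits.CriticalPhenomena.CardyFormulaZ2.Theorems.CardyComplexConeSLESixFamiliesGiveCardyUpperFencePart2
import Summits.CriticalPhenomena.CardyFormulaZ2.Theorems.CardyComplexConeSLESixFamiliesGiveCardyUpperFencePart3
import Summits.CriticalPhenomena.CardyFormulaZ2.Theorems.CardyComplexConeSLESixFamiliesGiveCardyLowerRunPart2
import HarnessLib

/-!
# Stub `upperFence` of line `collar-touch-sandwich` — Part 4: the fence argument at one mesh

Crux `SLESixFamiliesGiveCardy` (stmt-CriticalPhenomena-9654), route `CardyComplexCone`.
Kernel of `theorem stub_upperFence : UpperFence` (the eventual wrapper is the next file) — the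
deterministic UPPER half of the touch sandwich:
under `UpperCollarGeom R D G`, for every discretisation family `Λ` of the designer Dobrushin
domain `D ⊇ Ω` and every `η > 0`, for all small meshes a free open crossing `(ab)_δ ↔ (cd)_δ` of
`Ω_δ` forces the trace of the medial exploration interface of `Λ δ` to meet the closed
`η`-neighbourhood of the touch set `G`.

The kernel `upperFence_kernel` is a statement at ONE admissible mesh.  Separation is by Newman's
cross-cut theorem (`Newman1939_crosscut_holds`, proved in the tree) applied to the CLEANED open
crossing: the open `Ω_δ`-path `π`, extended at both ends along first-exit connectors to
`∂Ω ⊆ ∂D` (`exists_frontier_exit_not_adj`), is a simple arc (`isSimpleArc_connector_meshTrace_connector`)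
containing a cross-cut `L′` of `D` from the open wired arc to the open dual arc
(`exists_clean_crosscut`); the uniform side balls at the two marks (`exists_uniform_side_ball`,
chosen BEFORE the mesh) put the two ends of the perturbed exploration polygon
(`IsMedialExploration.subPath`, a path inside `D`: `pertTrace_subset_carrier_of_eq`) in the two
Newman components, so the polygon meets `L′` (`inter_nonempty_of_isPreconnected_of_meets`) at a
point of a lattice edge `e`; by the free-segment dictionary `edge_of_mem_edgeTrace` the edge `e`
is CROSSED by the exploration, hence a side of an inner face and closed under the boundary
condition: if `e` is an edge of `π` it is `ω`-open and an `Ω_δ`-, hence `D_δ`-edge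
(`eventually_discreteDomainGraph_le`), so it has a dual-wired endpoint inside `Ω`
(`exists_mem_zdArcB_of_adj_of_not_mem_bcBondConfig`), which is near `G`
(`upperFence_dual_near_touch'`), and its midpoint is a vertex of the interface polyline; if `e`
is a connector edge this contradicts connector exclusion (`eventually_connector_not_adj`).
Orientation of the exploration never enters (range event, symmetric separation).  The recipe and
the helper lemmas of Parts 1–2 are the crux's `drefute` refuters' (gens 3–6); assembly by the lead.
-/

noncomputable section

open Set Filter Topology Metric
open scoped NNReal Pointwise
open Literature.Probability Literature.Probability.RandomPlanarGeometry
  Literature.Probability.LatticeModels Literature.Probability.Percolation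
open Literature.Probability.LatticeModels.IsMedialExploration
open Literature.Topology.PlaneTopology (IsSimpleArc Newman1939_crosscut_holds)

namespace Summit.CriticalPhenomena.CardyFormulaZ2.Cruxes.SLESixFamiliesGiveCardy.CollarTouchSandwich

/-! ### Small lattice facts -/

/-- The vertices of a walk of `openGraph ω ⊓ Ω_δ` starting at a site of `Ω_δ` are sites of `Ω_δ`. -/
theorem support_subset_meshDomain {Ω : Set ℂ} {δ : ℝ} {ω : BondConfig (Site 2)} {u v : Site 2}
    (q : (openGraph ω ⊓ discreteDomainGraph Ω δ).Walk u v) (hu : u ∈ meshDomain Ω δ) :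
    ∀ w ∈ q.support, w ∈ meshDomain Ω δ := by
  induction q with
  | nil => intro w hw; rw [SimpleGraph.Walk.support_nil, List.mem_singleton] at hw; exact hw ▸ hu
  | cons h q ih =>
    intro w hw
    rw [SimpleGraph.Walk.support_cons, List.mem_cons] at hw
    rcases hw with rfl | hw
    · exact hu
    · exact ih (discreteDomainGraph_adj_iff.1 h.2).2.2 w hw

/-- A point of a scaled lattice segment, unscaled. -/
theorem inv_smul_mem_edgeTrace {δ : ℝ} (hδ : 0 < δ) {e : Sym2 (Site 2)} {z : ℂ}
    (hz : z ∈ meshScale δ '' edgeTrace e) : δ⁻¹ • z ∈ edgeTrace e := by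
  obtain ⟨z₀, hz₀, rfl⟩ := hz
  rwa [meshScale_apply, Complex.real_smul, Complex.ofReal_inv, inv_mul_cancel_left₀
    (by exact_mod_cast hδ.ne')]

/-- `infDist ≤ η` places a point in the closed `η`-thickening of a nonempty set. -/
theorem mem_cthickening_of_infDist_le {p : ℂ} {G : Set ℂ} (hG : G.Nonempty) {η : ℝ}
    (h : infDist p G ≤ η) : p ∈ cthickening η G := by
  rw [mem_cthickening_iff, ← ENNReal.ofReal_toReal (infEDist_ne_top hG)]
  exact ENNReal.ofReal_le_ofReal h

/-! ### The kernel at one admissible mesh -/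

/-- **The fence argument at one admissible mesh** (all `ω`-free constants fixed beforehand; see the
module docstring for the proof). -/
theorem upperFence_kernel (R : ConformalRectangle) (D : DobrushinDomain) {G : Set ℂ}
    {E : DiscreteDobrushin} (hE : E.IsZdAdmissible) (hΩ : E.Ω = D.carrier)
    (hRD : R.carrier ⊆ D.carrier) (hpt : ∀ i : Fin 2, D.pt i ∉ closure R.carrier)
    {r₀ r₂ : ℝ} (hr₀ : ∀ z ∈ frontier R.carrier, infDist z (R.arc 0) < r₀ → z ∈ D.arc 0)
    (hr₂ : ∀ z ∈ frontier R.carrier, infDist z (R.arc 2) < r₂ → z ∈ D.arc 1)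
    (hδr₀ : 2 * E.δ < r₀) (hδr₂ : 2 * E.δ < r₂)
    {ρ : ℝ} (hρ : ∀ p ∈ R.arc 0, ∀ q ∈ R.arc 2, ρ ≤ dist p q) (hδρ : 4 * E.δ < ρ)
    {τa τb ε₀ : ℝ} (hτa0 : 0 < τa) (hτb0 : 0 < τb)
    (hballa : Disjoint (ball (D.pt 0) τa) (closure R.carrier))
    (hsidea : ∀ s t : ℝ, D.boundary s ∈ closure R.carrier → D.boundary t ∈ closure R.carrier →
      (∀ k : ℤ, D.mark 0 + k ∉ Icc s t) → Disjoint (ball (D.pt 0) τa) (D.boundary '' Icc s t))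
    (hballb : Disjoint (ball (D.pt 1) τb) (closure R.carrier))
    (hsideb : ∀ s t : ℝ, D.boundary s ∈ closure R.carrier → D.boundary t ∈ closure R.carrier →
      (∀ k : ℤ, D.mark 1 + k ∉ Icc s t) → Disjoint (ball (D.pt 1) τb) (D.boundary '' Icc s t))
    (hmarks : ∀ i : Fin 2, ∃ e ∈ E.zdABEdges, dist (medialPoint E.δ e) (D.pt i) < ε₀)
    (hτa : 3 * E.δ + ε₀ < τa) (hτb : 3 * E.δ + ε₀ < τb)
    {η : ℝ} (hGne : G.Nonempty) (hδη : E.δ ≤ η / 2)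
    (hnear : ∀ w ∈ E.zdArcB, meshPoint E.δ w ∈ R.carrier → infDist (meshPoint E.δ w) G ≤ η / 2)
    (hle : discreteDomainGraph R.carrier E.δ ≤ discreteDomainGraph E.Ω E.δ)
    (hconn : ∀ k : Fin 4, (k = 0 ∨ k = 2) → ∀ x ∈ discreteArc R.carrier E.δ (R.arc k),
      ∀ y : Site 2, (zdGraph 2).Adj x y → ¬ (discreteDomainGraph R.carrier E.δ).Adj x y →
        ¬ (discreteDomainGraph E.Ω E.δ).Adj x y)
    {ω : BondConfig (Site 2)} (hω : ω ∈ discreteCrossing R.carrier E.δ (R.arc 0) (R.arc 2)) :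
    (range (medialExplorationCurve E ω) ∩ cthickening η G).Nonempty := by
  have hδ : 0 < E.δ := hE.delta_pos
  have hδabs : |E.δ| = E.δ := abs_of_pos hδ
  /- the exploration -/
  have hexp₀ := isMedialExploration_medialExploration_holds E hE ω
  obtain ⟨a, l, hal⟩ : ∃ a l, medialExploration E ω = a :: l := by
    cases h : medialExploration E ω with
    | nil => exact absurd h hexp₀.ne_nil
    | cons a l => exact ⟨a, l, rfl⟩
  rw [hal] at hexp₀
  have hexp : IsMedialExploration E ω (a :: l) := hexp₀
  have hl : l ≠ [] := by
    intro h; subst h; exact hexp.head_ne_getLast rfl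
  have hlen : 0 < l.length := List.length_pos_iff.2 hl
  have hn : ((a :: l).zip l).length = l.length := by simp
  set k : ℕ := l.length - 1 with hk
  have hk0 : 0 < ((a :: l).zip l).length := by rw [hn]; exact hlen
  have hkn : 0 + k < ((a :: l).zip l).length := by rw [hn]; omega
  /- the two `A`–`B` edges and the ends of the perturbed polygon -/
  set b : MedialVertex := (a :: l).getLast (List.cons_ne_nil a l) with hb
  have ha_mem : a ∈ E.zdABEdges := hexp.head_mem
  have hb_mem : b ∈ E.zdABEdges := hexp.getLast_mem
  have hab : a ≠ b := hexp.head_ne_getLast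
  have hsrc0 : cornerSource (hexp.cv 0) (hexp.cf 0) = a := by
    rw [(hexp.corner_spec hk0).2.2.1, List.getElem_zip]; rfl
  have htgtk : cornerTarget (hexp.cv (0 + k)) (hexp.cf (0 + k)) = b := by
    rw [(hexp.corner_spec hkn).2.2.2, hb, getLast_eq_getElem_zip_snd a l hlen]
    simp only [hk, Nat.zero_add]
  set T : Set ℂ := range (hexp.subPath 0 k) with hT
  have hTpre : IsPreconnected T := isPreconnected_range (hexp.subPath 0 k).continuous
  have hTsub : T ⊆ hexp.pertTrace := hexp.range_subPath_subset_pertTrace hkn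
  have hTD : T ⊆ D.carrier :=
    hTsub.trans (pertTrace_subset_carrier_of_eq (Dm := D) hΩ rfl hδ hexp)
  have hPS : hexp.pS 0 ∈ T := ⟨0, (hexp.subPath 0 k).source⟩
  have hPT : hexp.pT (0 + k) ∈ T := ⟨1, (hexp.subPath 0 k).target⟩
  have hnearA : dist (hexp.pS 0) (medialPoint E.δ a) ≤ 3 * E.δ := by
    have h1 := (hexp.dist_pS_le hδ hk0).1
    have h2 := dist_medialPoint_cornerSource_le hδ.le (hexp.isCorner hk0)
    rw [hsrc0] at h2
    linarith [dist_triangle (hexp.pS 0) (meshPoint E.δ (hexp.cv 0)) (medialPoint E.δ a),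
      dist_comm (meshPoint E.δ (hexp.cv 0)) (medialPoint E.δ a)]
  have hnearB : dist (hexp.pT (0 + k)) (medialPoint E.δ b) ≤ 3 * E.δ := by
    have h1 := (hexp.dist_pS_le hδ hkn).2
    have h2 := dist_medialPoint_cornerTarget_le hδ.le (hexp.isCorner hkn)
    rw [htgtk] at h2
    linarith [dist_triangle (hexp.pT (0 + k)) (meshPoint E.δ (hexp.cv (0 + k))) (medialPoint E.δ b),
      dist_comm (meshPoint E.δ (hexp.cv (0 + k))) (medialPoint E.δ b)]
  -- every `A`–`B` edge is `a` or `b`, so each mark has an end of `T` nearby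
  have hAB : ∀ e ∈ E.zdABEdges, e = a ∨ e = b := by
    obtain ⟨x, y, -, hxy⟩ := Set.ncard_eq_two.1 hE.ncard_zdABEdges_eq_two
    have ha' : a = x ∨ a = y := by simpa [hxy] using ha_mem
    have hb' : b = x ∨ b = y := by simpa [hxy] using hb_mem
    intro e he
    have he' : e = x ∨ e = y := by simpa [hxy] using he
    rcases he' with h | h <;> rcases ha' with h1 | h1 <;> rcases hb' with h2 | h2 <;>
      first
      | exact Or.inl (h.trans h1.symm)
      | exact Or.inr (h.trans h2.symm)
      | exact absurd (h1.trans h2.symm) hab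
  have hend : ∀ i : Fin 2, ∃ z ∈ T, dist z (D.pt i) < 3 * E.δ + ε₀ := by
    intro i
    obtain ⟨e, he, hed⟩ := hmarks i
    rcases hAB e he with h | h <;> rw [h] at hed
    · exact ⟨_, hPS, by linarith [dist_triangle (hexp.pS 0) (medialPoint E.δ a) (D.pt i)]⟩
    · exact ⟨_, hPT, by linarith [dist_triangle (hexp.pT (0 + k)) (medialPoint E.δ b) (D.pt i)]⟩
  /- the open crossing as a lattice path -/
  obtain ⟨x, hx, y, hy, hreach⟩ := hω
  have hx0 : infDist (meshPoint E.δ x) (R.arc 0) ≤ E.δ := by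
    have := infDist_le_of_mem_discreteArc R.isOpen hx; rwa [hδabs] at this
  have hy2 : infDist (meshPoint E.δ y) (R.arc 2) ≤ E.δ := by
    have := infDist_le_of_mem_discreteArc R.isOpen hy; rwa [hδabs] at this
  have hfar : 2 * E.δ < dist (meshPoint E.δ x) (meshPoint E.δ y) := by
    obtain ⟨p, hp, hdp⟩ := (R.isCompact_arc 0).exists_infDist_eq_dist ⟨_, R.pt_mem_arc_self 0⟩
      (meshPoint E.δ x)
    obtain ⟨q, hq, hdq⟩ := (R.isCompact_arc 2).exists_infDist_eq_dist ⟨_, R.pt_mem_arc_self 2⟩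
      (meshPoint E.δ y)
    have h := hρ p hp q hq
    rw [hdp] at hx0; rw [hdq] at hy2
    linarith [dist_triangle4 p (meshPoint E.δ x) (meshPoint E.δ y) q,
      dist_comm p (meshPoint E.δ x)]
  have hxy : x ≠ y := by
    rintro rfl; rw [dist_self] at hfar; linarith
  set H := openGraph ω ⊓ discreteDomainGraph R.carrier E.δ with hH
  have hHle : H ≤ zdGraph 2 := fun u v huv =>
    meshGraph_le_zdGraph _ _ (discreteDomainGraph_le_meshGraph _ _ huv.2)
  obtain ⟨p⟩ := hreach
  set q : H.Walk x y := p.bypass with hq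
  have hqpath : q.IsPath := p.bypass_isPath
  set π : (zdGraph 2).Walk x y := q.mapLe hHle with hπ
  have hπpath : π.IsPath := by
    rw [SimpleGraph.Walk.isPath_def, hπ, SimpleGraph.Walk.support_mapLe_eq_support]
    exact hqpath.support_nodup
  have hπn : ¬ π.Nil := fun h => hxy h.eq
  have hsupp : ∀ v ∈ π.support, v ∈ meshDomain R.carrier E.δ := by
    rw [hπ, SimpleGraph.Walk.support_mapLe_eq_support]
    exact support_subset_meshDomain q hx.1.1
  have hedgesH : ∀ e ∈ π.edges, e ∈ H.edgeSet := by
    rw [hπ, SimpleGraph.Walk.edges_mapLe_eq_edges]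
    exact fun e he => q.edges_subset_edgeSet he
  have hedges : ∀ e ∈ π.edges, e ∈ (discreteDomainGraph R.carrier E.δ).edgeSet := fun e he => by
    have := hedgesH e he
    rw [SimpleGraph.edgeSet_inf] at this
    exact this.2
  /- the two exits -/
  obtain ⟨x', fx, hxx', hnx, hfxfr, hfxseg, hfxcl, -⟩ := exists_frontier_exit_not_adj R.isOpen hx.1
  obtain ⟨y', fy, hyy', hny, hfyfr, hfyseg, hfycl, -⟩ := exists_frontier_exit_not_adj R.isOpen hy.1
  have hnotΩ : ∀ f ∈ frontier R.carrier, f ∉ R.carrier := fun f hf h => by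
    rw [R.isOpen.frontier_eq] at hf; exact hf.2 h
  have hxΩ : meshPoint E.δ x ∈ R.carrier := meshDomain_subset_meshVertices _ _ hx.1.1
  have hyΩ : meshPoint E.δ y ∈ R.carrier := meshDomain_subset_meshVertices _ _ hy.1.1
  obtain ⟨tx, htxI, hfx⟩ : ∃ t ∈ Icc (0 : ℝ) 1, fx = meshPoint E.δ x + t • (meshPoint E.δ x' - meshPoint E.δ x) := by
    rw [segment_eq_image'] at hfxseg; obtain ⟨t, ht, rfl⟩ := hfxseg; exact ⟨t, ht, rfl⟩
  obtain ⟨ty, htyI, hfy⟩ : ∃ t ∈ Icc (0 : ℝ) 1, fy = meshPoint E.δ y + t • (meshPoint E.δ y' - meshPoint E.δ y) := by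
    rw [segment_eq_image'] at hfyseg; obtain ⟨t, ht, rfl⟩ := hfyseg; exact ⟨t, ht, rfl⟩
  have htx0 : 0 < tx := by
    rcases htxI.1.eq_or_lt with h | h
    · exfalso; apply hnotΩ fx hfxfr; rw [hfx, ← h, zero_smul, add_zero]; exact hxΩ
    · exact h
  have hty0 : 0 < ty := by
    rcases htyI.1.eq_or_lt with h | h
    · exfalso; apply hnotΩ fy hfyfr; rw [hfy, ← h, zero_smul, add_zero]; exact hyΩ
    · exact h
  have hfxΩ : fx ∉ R.carrier := hnotΩ fx hfxfr
  have hfyΩ : fy ∉ R.carrier := hnotΩ fy hfyfr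
  have hdfx : dist fx (meshPoint E.δ x) ≤ E.δ :=
    dist_le_of_mem_connector hδ hxx' htx0 htxI.2 hfx (right_mem_segment ℝ _ _)
  have hdfy : dist fy (meshPoint E.δ y) ≤ E.δ :=
    dist_le_of_mem_connector hδ hyy' hty0 htyI.2 hfy (right_mem_segment ℝ _ _)
  have hfxA : fx ∈ D.arc 0 := hr₀ fx hfxfr (by
    linarith [infDist_le_infDist_add_dist (s := R.arc 0) (x := fx) (y := meshPoint E.δ x)])
  have hfyB : fy ∈ D.arc 1 := hr₂ fy hfyfr (by
    linarith [infDist_le_infDist_add_dist (s := R.arc 2) (x := fy) (y := meshPoint E.δ y)])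
  /- the dirty cross-cut and its cleaning -/
  set L : Set ℂ := (segment ℝ fx (meshPoint E.δ x) ∪ meshTrace E.δ π) ∪
    segment ℝ (meshPoint E.δ y) fy with hLdef
  have hLarc : IsSimpleArc L fx fy :=
    isSimpleArc_connector_meshTrace_connector hδ hπpath hπn hsupp hedges hxx' hnx hyy' hny htx0
      htxI.2 hfx hfxΩ hty0 htyI.2 hfy hfyΩ hfar
  have hπcl : meshTrace E.δ π ⊆ closure R.carrier := by
    intro z hz
    obtain ⟨e', he', hze'⟩ := mem_meshTrace_iff.1 hz
    have hE' := hedges e' he'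
    revert hze' hE'
    induction e' using Sym2.ind with
    | h u w =>
      intro hze' hE'
      rw [SimpleGraph.mem_edgeSet] at hE'
      rw [← segment_meshPoint_eq_image] at hze'
      exact (meshGraph_adj_iff.1 (discreteDomainGraph_le_meshGraph _ _ hE')).2 hze'
  have hLcl : L ⊆ closure R.carrier := by
    rintro z ((hz | hz) | hz)
    · rw [segment_symm] at hz; exact hfxcl hz
    · exact hπcl hz
    · exact hfycl hz
  obtain ⟨L', s, t, hL'L, hs0, hs1, ht1, ht0, hcut⟩ :=
    exists_clean_crosscut D (closure_mono hRD) hpt hLarc hLcl hfxA hfyB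
  have hL'cl : L' ⊆ closure R.carrier := hL'L.trans hLcl
  have hbs : D.boundary s ∈ closure R.carrier := hL'cl hcut.1.left_mem
  have hbt : D.boundary t ∈ closure R.carrier := hL'cl hcut.1.right_mem
  /- Newman -/
  obtain ⟨U₁, U₂, hU₁o, hU₂o, -, -, hdisj, hunion, hf₁, hf₂⟩ :=
    Newman1939_crosscut_holds D.toJordanDomain L' s t (by linarith) (by linarith) hcut
  have hU₁D : U₁ ⊆ D.carrier := fun z hz => ((hunion ▸ Or.inl hz : z ∈ D.carrier \ L')).1
  have hU₂D : U₂ ⊆ D.carrier := fun z hz => ((hunion ▸ Or.inr hz : z ∈ D.carrier \ L')).1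
  have hptD : ∀ i : Fin 2, D.pt i ∉ D.carrier := fun i h => by
    have : D.pt i ∈ D.carrier ∩ frontier D.carrier := ⟨h, D.pt_mem_frontier i⟩
    rw [D.isOpen.inter_frontier_eq] at this
    exact this
  -- the uniform side balls
  have hdisja : Disjoint (ball (D.pt 0) τa) U₁ := by
    refine ball_disjoint_of_disjoint_frontier hU₁o ?_ hτa0 (fun h => hptD 0 (hU₁D h))
    rw [hf₁]
    exact Set.disjoint_union_right.2 ⟨hballa.mono_right hL'cl,
      hsidea s t hbs hbt (forall_int_add_notMem_Icc hs0 ht0)⟩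
  have hdisjb : Disjoint (ball (D.pt 1) τb) U₂ := by
    refine ball_disjoint_of_disjoint_frontier hU₂o ?_ hτb0 (fun h => hptD 1 (hU₂D h))
    rw [hf₂]
    refine Set.disjoint_union_right.2 ⟨hballb.mono_right hL'cl, hsideb t (s + 1) hbt ?_ ?_⟩
    · rw [D.periodic_boundary]; exact hbs
    · exact forall_int_add_notMem_Icc ht1 (by linarith)
  -- the two ends of `T` lie in the two components
  obtain ⟨z₀, hz₀T, hz₀d⟩ := hend 0
  obtain ⟨z₁, hz₁T, hz₁d⟩ := hend 1
  have hmemU : ∀ {z : ℂ} {U U' : Set ℂ} {p : ℂ} {τ : ℝ}, z ∈ T → dist z p < τ →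
      Disjoint (ball p τ) (closure R.carrier) → Disjoint (ball p τ) U → U ∪ U' = D.carrier \ L' →
        z ∈ U' := by
    intro z U U' p τ hzT hzd hballp hdisjp hun
    have hzb : z ∈ ball p τ := mem_ball.2 hzd
    have hzL' : z ∉ L' := fun h => Set.disjoint_left.1 hballp hzb (hL'cl h)
    have : z ∈ U ∪ U' := by rw [hun]; exact ⟨hTD hzT, hzL'⟩
    exact this.resolve_left fun h => Set.disjoint_left.1 hdisjp hzb h
  have hz₀U₂ : z₀ ∈ U₂ := hmemU hz₀T (by linarith) hballa hdisja hunion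
  have hz₁U₁ : z₁ ∈ U₁ :=
    hmemU hz₁T (by linarith) hballb hdisjb (by rw [union_comm]; exact hunion)
  /- the crossing point -/
  obtain ⟨z, hzT, hzL'⟩ := inter_nonempty_of_isPreconnected_of_meets hTpre hTD hunion hU₁o hU₂o
    hdisj ⟨z₁, hz₁T, hz₁U₁⟩ ⟨z₀, hz₀T, hz₀U₂⟩
  have hzP : z ∈ hexp.pertTrace := hTsub hzT
  /- dictionary -/
  -- connectors cannot be met
  have hconnector : ∀ {u u' : Site 2} (k' : Fin 4), (k' = 0 ∨ k' = 2) →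
      u ∈ discreteArc R.carrier E.δ (R.arc k') → (zdGraph 2).Adj u u' →
      ¬ (discreteDomainGraph R.carrier E.δ).Adj u u' → ∀ {tu : ℝ}, 0 < tu → tu ≤ 1 →
      ∀ {fu : ℂ}, fu = meshPoint E.δ u + tu • (meshPoint E.δ u' - meshPoint E.δ u) →
      z ∈ segment ℝ (meshPoint E.δ u) fu → False := by
    intro u u' k' hk' hu huu' hnu tu htu0 htu1 fu hfu hzseg
    have hz' : z ∈ meshScale E.δ '' edgeTrace s(u, u') := by
      rw [← segment_meshPoint_eq_image]
      rw [hfu] at hzseg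
      exact subsegment_subset htu0.le htu1 hzseg
    obtain ⟨i, hi, -, hsrc, -⟩ := hexp.edge_of_mem_edgeTrace hδ huu' hzP (inv_smul_mem_edgeTrace hδ hz')
    exact hconn k' hk' u hu u' huu' hnu
      (adj_of_cornerSource_eq (hexp.isCorner hi.2) (hexp.isInnerFace hi.2) hsrc.symm)
  rcases hL'L hzL' with (hz | hz) | hz
  · exact absurd (hconnector 0 (Or.inl rfl) hx hxx' hnx htx0 htxI.2 hfx
      (by rwa [segment_symm] at hz)) id
  swap
  · exact absurd (hconnector 2 (Or.inr rfl) hy hyy' hny hty0 htyI.2 hfy hz) id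
  -- on the open crossing: the crossed edge is bc-closed and `ω`-open, so it touches `zdArcB`
  obtain ⟨e', he', hze'⟩ := mem_meshTrace_iff.1 hz
  have hE' := hedgesH e' he'
  revert hze' hE'
  induction e' using Sym2.ind with
  | h u w =>
    intro hze' hE'
    rw [SimpleGraph.mem_edgeSet] at hE'
    have huw : (zdGraph 2).Adj u w := hHle hE'
    obtain ⟨i, hi, hzip, -, hbc⟩ :=
      hexp.edge_of_mem_edgeTrace hδ huw hzP (inv_smul_mem_edgeTrace hδ hze')
    -- a dual-wired endpoint inside `Ω`
    have huΩ : meshPoint E.δ u ∈ R.carrier :=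
      meshDomain_subset_meshVertices _ _ (discreteDomainGraph_adj_iff.1 hE'.2).2.1
    have hwΩ : meshPoint E.δ w ∈ R.carrier :=
      meshDomain_subset_meshVertices _ _ (discreteDomainGraph_adj_iff.1 hE'.2).2.2
    obtain ⟨w', hw'B, hw'Ω, hdw'⟩ : ∃ w' ∈ E.zdArcB, meshPoint E.δ w' ∈ R.carrier ∧
        dist (medialPoint E.δ s(u, w)) (meshPoint E.δ w') ≤ E.δ := by
      have hd := dist_medialPoint_le_of_adj (δ := E.δ) huw
      rw [hδabs] at hd
      rcases exists_mem_zdArcB_of_adj_of_not_mem_bcBondConfig E hle hE' hbc with h | h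
      · exact ⟨u, h, huΩ, hd.1⟩
      · exact ⟨w, h, hwΩ, hd.2⟩
    -- the midpoint of the crossed edge is on the interface and within `η` of `G`
    refine ⟨medialPoint E.δ s(u, w), ?_, ?_⟩
    · show medialPoint E.δ s(u, w) ∈ range (polyline ((medialExploration E ω).map (medialPoint E.δ)))
      rw [hal]
      refine mem_range_polyline (List.mem_map.2 ⟨_, ?_, rfl⟩)
      rw [hzip]
      exact (List.of_mem_zip (List.getElem_mem hi.2)).1
    · refine mem_cthickening_of_infDist_le hGne ?_
      have h1 := hnear w' hw'B hw'Ω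
      have h2 := infDist_le_infDist_add_dist (s := G) (x := medialPoint E.δ s(u, w))
        (y := meshPoint E.δ w')
      linarith

/-- Registered sub-goal of STUB A (Part 4 of `stub_upperFence`): arrow form of
`mem_cthickening_of_infDist_le` (the file's main content is `upperFence_kernel`). -/
theorem upperFence_part4 : ∀ (p : ℂ) (G : Set ℂ), G.Nonempty → ∀ η : ℝ, infDist p G ≤ η → p ∈ cthickening η G :=
  fun _ _ hG _ h ↦ mem_cthickening_of_infDist_le hG h

end Summit.CriticalPhenomena.CardyFormulaZ2.Cruxes.SLESixFamiliesGiveCardy.CollarTouchSandwich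

end
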